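import Literature.Computability.Complexity.MeyerVerifier
import HarnessLib

/-!
# Meyer's theorem, the `Σ₂ᵖ` verifier II: the evidence word, the judge, the matrix is in `P`

Third file of the proof of **Meyer's theorem** `EXP ⊆ P/poly ⟹ EXP = Σ₂ᵖ` (Arora–Barak 2009,
Thm. 6.20; Karp–Lipton 1980, §6), continuing `MeyerVerifier.lean`. The matrix of the `Σ₂ᵖ`
sentence — Arora–Barak's "`T` is some polynomial-time TM checking these conditions" — is
organised as **evidence + judge**:

* `Meyer.flagsFn` — the ten arithmetic side conditions of a local check at the descriptor
  `(t, J₀)` (descriptor widths, `t < 2^q`, `J₀ + 2d < 2^R`, `J₀ < d + 1`, `J₀ < 2^h`, `J₀ < 1`,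
  `J₀ < n + 1`), each a comparison `Brick.ltFn`; `Meyer.bitFn` — the bit of `x` the start-row
  check needs (`binToUnaryFn`, `bitAtFn`); `Meyer.evidFn` — **the evidence word**: flags, the
  answer bits of all blocks (`Meyer.answersFn`), the start-row bit; it is in `FP`
  (`Meyer.evidFn_mem_FP`) and has bounded length (`Meyer.length_evidFn_le`), and its value is
  explicit (`Meyer.flagsFn_apply`, `Meyer.judgeVal_answersFn`: position `i` of the answers
  decodes to the claimed row value `rho` at the indices of block `i`).
* `Meyer.judge` — **the judge**, an ARBITRARY Boolean function of the evidence word (hence of a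
  bounded prefix of its input, so `matFn ∈ FP` by `prefixFn_mem_FP` with no further machine):
  decode (`Meyer.JudgeProp`) and check (`Meyer.JudgeSem`) the top rule for row `t + 1`
  (`Tableau.topF`), the interior rule at block `J₀ + d` (`Tableau.intF`), the start row at `J₀`,
  emptiness at `J₀ ≥ 2^h`, and the accepting output cell — exactly the local check `Meyer.Check`
  on the claimed rows (`Meyer.judge_evidFn_iff`, **the matrix lemma**; malformed descriptors are
  accepted, `Meyer.judge_evidFn_of_ne`).
* `Meyer.MatLang` — the matrix language, in `P` (`Meyer.matLang_mem_P`).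

## References

* S. Arora, B. Barak, *Computational Complexity: A Modern Approach*, CUP 2009, Thm. 6.20 (proof
  sketch, p. 114), §1.3.
* R. M. Karp, R. J. Lipton, *Some connections between nonuniform and uniform complexity classes*,
  Proc. 12th STOC (1980) 302–309, §6.
-/

namespace Literature.Computability.Complexity

namespace Meyer

open _root_.Computability Turing Polynomial Tableau Brick Plumb

variable (M : TM2ComputableAux Bool Bool)

/-! ### The arithmetic side conditions and the evidence word -/

section Evidence

variable (qP hP : Polynomial ℕ)

/-- **The ten flag bits** of a local check at `u = ⟨⟨x, W⟩, ⟨T', J₀'⟩⟩` (`n = |x|`, `Q = qP n + 1`,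
`R = hP n + 1`, `t = ⟦T'⟧`, `J₀ = ⟦J₀'⟧`), each an `FP` comparison `ltFn`:
`|T'| < Q`, `Q < |T'|`, `|J₀'| < R`, `R < |J₀'|` (descriptor widths), `t < 2^q`,
`J₀ + 2d < 2^R`, `J₀ < d + 1`, `J₀ < 2^h`, `J₀ < 1`, `J₀ < n + 1`. [folklore] -/
noncomputable def flagsFn (d : ℕ) : List (List Bool → List Bool) :=
  [ltFn ∘ pairFn (lenBinF ∘ rowU) (lenBinF ∘ ruler (qP + 1)),
    ltFn ∘ pairFn (lenBinF ∘ ruler (qP + 1)) (lenBinF ∘ rowU),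
    ltFn ∘ pairFn (lenBinF ∘ colU) (lenBinF ∘ ruler (hP + 1)),
    ltFn ∘ pairFn (lenBinF ∘ ruler (hP + 1)) (lenBinF ∘ colU),
    ltFn ∘ pairFn rowU (pow2Fn qP),
    ltFn ∘ pairFn (addFn ∘ pairFn colU fun _ => encodeNat (2 * d)) (pow2Fn (hP + 1)),
    ltFn ∘ pairFn colU fun _ => encodeNat (d + 1),
    ltFn ∘ pairFn colU (pow2Fn hP),
    ltFn ∘ pairFn colU fun _ => encodeNat 1,
    ltFn ∘ pairFn colU (lenBinF ∘ List.cons true ∘ instU)]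

/-- **The bit of `x` the start-row check needs**: symbol `J₀` of `0x` (i.e. `x[J₀ - 1]` for
`1 ≤ J₀ ≤ n`), read by `bitAtFn` at the unary position `1^{min J₀ (n + 1)}` (`binToUnaryFn` against
the ruler `1x`); empty if `J₀ > n`. [folklore] -/
noncomputable def bitFn : List Bool → List Bool :=
  bitAtFn ∘ pairFn (binToUnaryFn ∘ pairFn (List.cons true ∘ instU) colU) (List.cons false ∘ instU)

/-- **The evidence word** of a local check: the ten flags, the answer bits of the `7d + 6` blocks,
and the start-row bit. [cite: AroraBarakCC2009, Thm. 6.20 (proof)] -/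
noncomputable def evidFn (A : Language Bool) (d : ℕ) (u : List Bool) : List Bool :=
  flattenFn (flagsFn qP hP d) u ++ (answersFn M qP hP A d u ++ bitFn u)

variable {qP hP}
variable (x W T' J' : List Bool)

/-- **Value of the flags.** [folklore] -/
theorem flagsFn_apply (d : ℕ) :
    flattenFn (flagsFn qP hP d) (boolPair (boolPair x W) (boolPair T' J')) =
      [decide (T'.length < qP.eval x.length + 1), decide (qP.eval x.length + 1 < T'.length),
        decide (J'.length < hP.eval x.length + 1), decide (hP.eval x.length + 1 < J'.length),
        decide (bitsToNat T' < 2 ^ qP.eval x.length),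
        decide (bitsToNat J' + 2 * d < 2 ^ (hP.eval x.length + 1)),
        decide (bitsToNat J' < d + 1), decide (bitsToNat J' < 2 ^ hP.eval x.length),
        decide (bitsToNat J' < 1), decide (bitsToNat J' < x.length + 1)] := by
  simp [flagsFn, bitsToNat_pow2Fn]

/-- **Value of the start-row bit.** [folklore] -/
theorem bitFn_apply :
    bitFn (boolPair (boolPair x W) (boolPair T' J')) =
      ((false :: x).drop (min (bitsToNat J') (x.length + 1))).take 1 := by
  simp [bitFn]

/-- The start-row bit inside the input: `[x[J₀ - 1]]` for `1 ≤ J₀ ≤ |x|`. [folklore] -/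
theorem bitFn_apply_of_le {i : ℕ} (hJ : bitsToNat J' = i + 1) (hi : i < x.length) :
    bitFn (boolPair (boolPair x W) (boolPair T' J')) = [x[i]] := by
  rw [bitFn_apply, hJ, min_eq_left (by omega), List.drop_succ_cons,
    List.take_one_drop_eq_of_lt_length hi]
  simp

variable (qP hP)

/-- Every flag is an `FP` function. [folklore] -/
theorem flagsFn_mem_FP (d : ℕ) : ∀ f ∈ flagsFn qP hP d, f ∈ FP := by
  intro f hf
  simp only [flagsFn, List.mem_cons, List.mem_nil_iff, or_false] at hf
  rcases hf with rfl | rfl | rfl | rfl | rfl | rfl | rfl | rfl | rfl | rfl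
  · exact comp_mem_FP ltFn_mem_FP (pairFn_mem_FP (comp_mem_FP lenBinF_mem_FP rowU_mem_FP)
      (comp_mem_FP lenBinF_mem_FP (ruler_mem_FP _)))
  · exact comp_mem_FP ltFn_mem_FP (pairFn_mem_FP (comp_mem_FP lenBinF_mem_FP (ruler_mem_FP _))
      (comp_mem_FP lenBinF_mem_FP rowU_mem_FP))
  · exact comp_mem_FP ltFn_mem_FP (pairFn_mem_FP (comp_mem_FP lenBinF_mem_FP colU_mem_FP)
      (comp_mem_FP lenBinF_mem_FP (ruler_mem_FP _)))
  · exact comp_mem_FP ltFn_mem_FP (pairFn_mem_FP (comp_mem_FP lenBinF_mem_FP (ruler_mem_FP _))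
      (comp_mem_FP lenBinF_mem_FP colU_mem_FP))
  · exact comp_mem_FP ltFn_mem_FP (pairFn_mem_FP rowU_mem_FP (pow2Fn_mem_FP _))
  · exact comp_mem_FP ltFn_mem_FP (pairFn_mem_FP
      (comp_mem_FP addFn_mem_FP (pairFn_mem_FP colU_mem_FP (const_mem_FP _))) (pow2Fn_mem_FP _))
  · exact comp_mem_FP ltFn_mem_FP (pairFn_mem_FP colU_mem_FP (const_mem_FP _))
  · exact comp_mem_FP ltFn_mem_FP (pairFn_mem_FP colU_mem_FP (pow2Fn_mem_FP _))
  · exact comp_mem_FP ltFn_mem_FP (pairFn_mem_FP colU_mem_FP (const_mem_FP _))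
  · exact comp_mem_FP ltFn_mem_FP (pairFn_mem_FP colU_mem_FP
      (comp_mem_FP lenBinF_mem_FP (comp_mem_FP (cons_mem_FP true) instU_mem_FP)))

/-- The start-row bit is an `FP` function. [folklore] -/
theorem bitFn_mem_FP : bitFn ∈ FP :=
  comp_mem_FP bitAtFn_mem_FP (pairFn_mem_FP
    (comp_mem_FP binToUnaryFn_mem_FP
      (pairFn_mem_FP (comp_mem_FP (cons_mem_FP true) instU_mem_FP) colU_mem_FP))
    (comp_mem_FP (cons_mem_FP false) instU_mem_FP))

/-- **The evidence function is in `FP`** for an advice language `A ∈ P`.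
[cite: AroraBarakCC2009, Thm. 6.20 (proof)] -/
theorem evidFn_mem_FP {A : Language Bool} (hA : A ∈ Classes.P) (d : ℕ) : evidFn M qP hP A d ∈ FP :=
  append_mem_FP (flattenFn_mem_FP (flagsFn_mem_FP qP hP d))
    (append_mem_FP (answersFn_mem_FP M qP hP hA d) bitFn_mem_FP)

end Evidence

/-! ### The value of the evidence word, and its decoding -/

section Decode

variable {M} {qP hP : Polynomial ℕ}
variable (x W T' J' : List Bool)

/-- **Value of the evidence word**: ten flags, the answer bits, the start-row bit.
[cite: AroraBarakCC2009, Thm. 6.20 (proof)] -/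
theorem evidFn_apply (A : Language Bool) (d : ℕ) :
    evidFn M qP hP A d (boolPair (boolPair x W) (boolPair T' J')) =
      flattenFn (flagsFn qP hP d) (boolPair (boolPair x W) (boolPair T' J')) ++
        (answersFn M qP hP A d (boolPair (boolPair x W) (boolPair T' J')) ++
          bitFn (boolPair (boolPair x W) (boolPair T' J'))) := rfl

/-- The flags segment has length `10`. [folklore] -/
theorem length_flags (d : ℕ) :
    (flattenFn (flagsFn qP hP d) (boolPair (boolPair x W) (boolPair T' J'))).length = 10 := by
  rw [flagsFn_apply]; rfl

/-- Every answer block has `|allVals|` bits. [folklore] -/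
theorem length_of_mem_answerBlocks {A : Language Bool} {d : ℕ} {l : List Bool}
    (hl : l ∈ (List.range (nBlocks d)).map (fun i => (allVals M).map
        (ans M A W (qP.eval x.length + 1) (hP.eval x.length + 1) x
          (rowVal (qP.eval x.length) (bitsToNat T') (blockSpec d i).1)
          (colVal (bitsToNat J') (blockSpec d i).2)))) :
    l.length = (allVals M).length := by
  rw [List.mem_map] at hl
  obtain ⟨i, -, rfl⟩ := hl
  exact List.length_map _

/-- A flattened list of blocks of equal length `V`: block `i` is recovered by dropping `i · V`
symbols and taking `V`. [folklore] -/
theorem take_drop_flatten_of_length {α : Type} {V : ℕ} :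
    ∀ (L : List (List α)) (_ : ∀ l, l ∈ L → l.length = V) (i : ℕ) (hi : i < L.length)
      (rest : List α), ((L.flatten ++ rest).drop (i * V)).take V = L[i]
  | [], _, i, hi, _ => absurd hi (Nat.not_lt_zero i)
  | l :: L, hL, 0, _, rest => by
    have hl : l.length = V := hL l (by simp)
    simp [← hl]
  | l :: L, hL, i + 1, hi, rest => by
    have hl : l.length = V := hL l (by simp)
    rw [List.flatten_cons, List.append_assoc, Nat.succ_mul, Nat.add_comm, ← List.drop_drop, ← hl,
      List.drop_left, hl]
    exact take_drop_flatten_of_length L (fun l' hl' => hL l' (by simp [hl'])) i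
      (by simpa using hi) rest

/-- The answers segment has length `(7d + 6) · |allVals|`. [folklore] -/
theorem length_answersFn {A : Language Bool} {d : ℕ} (hT : T'.length = qP.eval x.length + 1) :
    (answersFn M qP hP A d (boolPair (boolPair x W) (boolPair T' J'))).length =
      nBlocks d * (allVals M).length := by
  rw [answersFn_apply x W T' J' hT, List.length_flatten, List.map_map]
  have : (List.range (nBlocks d)).map (List.length ∘ fun i => (allVals M).map
      (ans M A W (qP.eval x.length + 1) (hP.eval x.length + 1) x
        (rowVal (qP.eval x.length) (bitsToNat T') (blockSpec d i).1)
        (colVal (bitsToNat J') (blockSpec d i).2))) =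
      (List.range (nBlocks d)).map fun _ => (allVals M).length := by
    refine List.map_congr_left fun i _ => ?_
    simp
  rw [this, List.map_const', List.sum_replicate, List.length_range, smul_eq_mul]

variable (M) in
/-- The block value the judge reads at position `i` of an answers segment `ab`: decode the `i`-th
group of `|allVals|` bits. [folklore] -/
noncomputable def judgeVal (ab : List Bool) (i : ℕ) : Val M.tm :=
  decodeBits M ((ab.drop (i * (allVals M).length)).take (allVals M).length)

/-- **The judge reads the claimed rows**: position `i < 7d + 6` of the answers segment of the
evidence decodes to `rho` at the row/block indices of block `i`. [cite: AroraBarakCC2009, Thm. 6.20 (proof)] -/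
theorem judgeVal_answersFn {A : Language Bool} {d : ℕ} (hT : T'.length = qP.eval x.length + 1)
    {i : ℕ} (hi : i < nBlocks d) (rest : List Bool) :
    judgeVal M (answersFn M qP hP A d (boolPair (boolPair x W) (boolPair T' J')) ++ rest) i =
      rho M A W (qP.eval x.length + 1) (hP.eval x.length + 1) x
        (rowVal (qP.eval x.length) (bitsToNat T') (blockSpec d i).1)
        (colVal (bitsToNat J') (blockSpec d i).2) := by
  rw [judgeVal, answersFn_apply x W T' J' hT,
    take_drop_flatten_of_length _ (fun l hl => length_of_mem_answerBlocks x W T' J' hl) i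
      (by simpa using hi) rest, List.getElem_map, List.getElem_range]
  rfl

end Decode

/-! ### The judge: an arbitrary finite function of the evidence -/

section Judge

variable {M}

/-- The start-row value the judge expects at block `J₀` of row `0`, from the flags `[J₀ < 1]`,
`[J₀ < n + 1]` and the start-row bit `x[J₀ - 1]`: the initial control, an input symbol, or
empty. [folklore] -/
noncomputable def startVal (f8 f9 b : Bool) : Val M.tm :=
  if f8 = true then ctrlVal M else if f9 = true then symVal M b else noneVal M.tm

variable (M) in
/-- **The judge's verdict on decoded evidence** (`fl i` = flag `i`, `val i` = the block value read
at position `i`, `b` = the start-row bit): if the descriptor is well-formed (flags `0 … 3` off)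
then — the top rule for row `t + 1` and the interior rule at `J₀ + d` whenever they apply
(`t < 2^q`; `J₀ ≥ d + 1` and `J₀ + 2d < 2^R`), the start row at `J₀`, emptiness at `J₀ ≥ 2^h`,
and the accepting output cell (Arora–Barak 2009, proof of Thm. 6.20: "`T` is some
polynomial-time TM checking these conditions"). [cite: AroraBarakCC2009, Thm. 6.20 (proof)] -/
def JudgeSem (d : ℕ) (fl : ℕ → Bool) (val : ℕ → Val M.tm) (b : Bool) : Prop :=
  (fl 0 = false ∧ fl 1 = false ∧ fl 2 = false ∧ fl 3 = false) →
    (fl 4 = true →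
        (∀ r : Fin (2 * d + 1), val (3 * d + 1 + r) = topF d (fun s => val s) r) ∧
          (fl 6 = false → fl 5 = true →
            val (7 * d + 3) = intF d (fun s => val s) fun s => val (5 * d + 2 + s))) ∧
      val (7 * d + 4) = startVal (fl 8) (fl 9) b ∧
      (fl 7 = false → val (5 * d + 2) = noneVal M.tm) ∧
      val (7 * d + 5) = accVal M

variable (M) in
/-- The judge's verdict on an evidence word: decode (flags at positions `0 … 9`, then
`(7d + 6) · |allVals|` answer bits, then the start-row bit) and apply `JudgeSem`. [folklore] -/
def JudgeProp (d : ℕ) (ev : List Bool) : Prop :=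
  JudgeSem M d (fun i => ev.getD i false) (judgeVal M (ev.drop 10))
    ((ev.drop (10 + nBlocks d * (allVals M).length)).headD false)

variable (M) in
open Classical in
/-- **The judge**, as a Boolean function of the evidence word. [cite: AroraBarakCC2009, Thm. 6.20 (proof)] -/
noncomputable def judge (d : ℕ) (ev : List Bool) : Bool :=
  decide (JudgeProp M d ev)

/-- Blocks `0 … 3d` are blocks `s` of row `t`. [folklore] -/
theorem blockSpec_head {d s : ℕ} (hs : s < 3 * d + 1) : blockSpec d s = (.cur, .const s) := by
  simp [blockSpec, hs]

/-- Blocks `3d + 1 … 5d + 1` are blocks `r` of row `t + 1`. [folklore] -/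
theorem blockSpec_top {d r : ℕ} (hr : r < 2 * d + 1) : blockSpec d (3 * d + 1 + r) = (.next, .const r) := by
  unfold blockSpec
  rw [if_neg (by omega), if_pos (by omega)]
  congr 2
  omega

/-- Blocks `5d + 2 … 7d + 2` are blocks `J₀ + s` of row `t`. [folklore] -/
theorem blockSpec_nbhd {d s : ℕ} (hs : s < 2 * d + 1) : blockSpec d (5 * d + 2 + s) = (.cur, .off s) := by
  unfold blockSpec
  rw [if_neg (by omega), if_neg (by omega), if_pos (by omega)]
  congr 2
  omega

/-- Block `7d + 3` is block `J₀ + d` of row `t + 1`. [folklore] -/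
theorem blockSpec_int (d : ℕ) : blockSpec d (7 * d + 3) = (.next, .off d) := by
  unfold blockSpec
  rw [if_neg (by omega), if_neg (by omega), if_neg (by omega), if_pos rfl]

/-- Block `7d + 4` is block `J₀` of row `0`. [folklore] -/
theorem blockSpec_zero (d : ℕ) : blockSpec d (7 * d + 4) = (.zero, .off 0) := by
  unfold blockSpec
  rw [if_neg (by omega), if_neg (by omega), if_neg (by omega), if_neg (by omega), if_pos rfl]

/-- Block `7d + 5` is block `1` of row `2^q`. [folklore] -/
theorem blockSpec_last (d : ℕ) : blockSpec d (7 * d + 5) = (.last, .const 1) := by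
  unfold blockSpec
  rw [if_neg (by omega), if_neg (by omega), if_neg (by omega), if_neg (by omega), if_neg (by omega)]

/-- **What the local check at `(t, J₀)` verifies about a row oracle `ρ`** (with `d`, time
exponent `q` — `T = 2^q` —, emptiness exponent `h` — `H = 2^h`, `R = h + 1` — and instance `x`):
the top rule for row `t + 1` and the interior rule at block `J₀ + d` (when `t < T` and the
blocks are in range), the start row at `J₀`, emptiness of block `J₀ ≥ H` of row `t`, and the
accepting output cell of row `T`. [cite: AroraBarakCC2009, Thm. 6.20 (proof)] -/
def Check (d q h : ℕ) (x : List Bool) (ρ : ℕ → ℕ → Val M.tm) (t J₀ : ℕ) : Prop :=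
  (t < 2 ^ q →
      (∀ r : Fin (2 * d + 1), ρ (t + 1) r = topF d (fun s => ρ t s) r) ∧
        (d + 1 ≤ J₀ → J₀ + 2 * d < 2 ^ (h + 1) →
          ρ (t + 1) (J₀ + d) = intF d (fun s => ρ t s) fun s => ρ t (J₀ + s))) ∧
    ρ 0 J₀ = absVal (rowCfg M x 0) J₀ ∧
    (2 ^ h ≤ J₀ → ρ t J₀ = noneVal M.tm) ∧
    ρ (2 ^ q) 1 = accVal M

/-- The start-row value expected by the judge is block `J₀` of the initial row. [folklore] -/
theorem startVal_eq (x : List Bool) (J₀ : ℕ) {b : Bool}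
    (hb : ∀ i, J₀ = i + 1 → ∀ hi : i < x.length, b = x[i]) :
    startVal (M := M) (decide (J₀ < 1)) (decide (J₀ < x.length + 1)) b = absVal (rowCfg M x 0) J₀ := by
  unfold startVal
  rcases Nat.eq_zero_or_pos J₀ with rfl | hJ
  · rw [if_pos (by simp), absVal_rowCfg_zero_zero]
  · obtain ⟨i, rfl⟩ : ∃ i, J₀ = i + 1 := ⟨J₀ - 1, by omega⟩
    rw [if_neg (by simp)]
    by_cases hi : i < x.length
    · rw [if_pos (by simp; omega), hb i rfl hi, absVal_rowCfg_zero_succ_of_eq_some x (List.getElem?_eq_getElem hi)]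
    · rw [if_neg (by simp; omega), absVal_rowCfg_zero_succ_of_le x (by omega)]

/-- **Semantics of the judge**: on the decoded evidence of a well-formed descriptor `(t, J₀)` —
flags as computed by `flagsFn`, block values `ρ` at the indices of `blockSpec`, start-row bit —
the judge accepts iff the local check `Check` holds for `ρ`. [cite: AroraBarakCC2009, Thm. 6.20 (proof)] -/
theorem judgeSem_iff {d q h : ℕ} {x : List Bool} {ρ : ℕ → ℕ → Val M.tm} {t J₀ : ℕ} {fl : ℕ → Bool}
    {b : Bool} (h0 : fl 0 = false) (h1 : fl 1 = false) (h2 : fl 2 = false) (h3 : fl 3 = false)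
    (h4 : fl 4 = decide (t < 2 ^ q)) (h5 : fl 5 = decide (J₀ + 2 * d < 2 ^ (h + 1)))
    (h6 : fl 6 = decide (J₀ < d + 1)) (h7 : fl 7 = decide (J₀ < 2 ^ h)) (h8 : fl 8 = decide (J₀ < 1))
    (h9 : fl 9 = decide (J₀ < x.length + 1))
    (hb : ∀ i, J₀ = i + 1 → ∀ hi : i < x.length, b = x[i]) :
    JudgeSem M d fl (fun i => ρ (rowVal q t (blockSpec d i).1) (colVal J₀ (blockSpec d i).2)) b ↔
      Check d q h x ρ t J₀ := by
  unfold JudgeSem Check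
  simp only [h0, h1, h2, h3, h4, h5, h6, h7, h8, h9, and_self, true_implies, decide_eq_true_eq,
    decide_eq_false_iff_not, not_lt, blockSpec_int, blockSpec_zero, blockSpec_last, rowVal, colVal,
    Nat.add_zero, startVal_eq x J₀ hb]
  have etop : ∀ r : Fin (2 * d + 1), blockSpec d (3 * d + 1 + r) = (.next, .const (r : ℕ)) :=
    fun r => blockSpec_top r.2
  have ehead : ∀ s : Fin (3 * d + 1), blockSpec d s = (.cur, .const (s : ℕ)) :=
    fun s => blockSpec_head s.2
  have ehead' : ∀ s : Fin (d + 1), blockSpec d s = (.cur, .const (s : ℕ)) :=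
    fun s => blockSpec_head (by have := s.2; omega)
  have enb : ∀ s : Fin (2 * d + 1), blockSpec d (5 * d + 2 + s) = (.cur, .off (s : ℕ)) :=
    fun s => blockSpec_nbhd s.2
  have enb0 : blockSpec d (5 * d + 2) = (.cur, .off 0) := by
    simpa using blockSpec_nbhd (d := d) (s := 0) (by omega)
  simp only [etop, ehead, ehead', enb, enb0, Nat.add_zero]

/-- `JudgeSem` only reads block values at positions `< 7d + 6`. [folklore] -/
theorem judgeSem_congr {d : ℕ} {fl : ℕ → Bool} {val val' : ℕ → Val M.tm} {b : Bool}
    (h : ∀ i, i < nBlocks d → val i = val' i) : JudgeSem M d fl val b ↔ JudgeSem M d fl val' b := by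
  have e1 : ∀ r : Fin (2 * d + 1), val (3 * d + 1 + r) = val' (3 * d + 1 + r) :=
    fun r => h _ (by have := r.2; unfold nBlocks; omega)
  have e2 : ∀ s : Fin (3 * d + 1), val s = val' s :=
    fun s => h _ (by have := s.2; unfold nBlocks; omega)
  have e2' : ∀ s : Fin (d + 1), val s = val' s :=
    fun s => h _ (by have := s.2; unfold nBlocks; omega)
  have e3 : ∀ s : Fin (2 * d + 1), val (5 * d + 2 + s) = val' (5 * d + 2 + s) :=
    fun s => h _ (by have := s.2; unfold nBlocks; omega)
  have e4 : val (7 * d + 3) = val' (7 * d + 3) := h _ (by unfold nBlocks; omega)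
  have e5 : val (7 * d + 4) = val' (7 * d + 4) := h _ (by unfold nBlocks; omega)
  have e6 : val (5 * d + 2) = val' (5 * d + 2) := h _ (by unfold nBlocks; omega)
  have e7 : val (7 * d + 5) = val' (7 * d + 5) := h _ (by unfold nBlocks; omega)
  unfold JudgeSem
  simp only [e1, e2, e2', e3, e4, e5, e6, e7]

variable {qP hP : Polynomial ℕ}
variable (x W T' J' : List Bool)

/-- Reading position `i ≤ 9` of a word starting with ten given symbols. [folklore] -/
theorem getD_ten {f0 f1 f2 f3 f4 f5 f6 f7 f8 f9 : Bool} {FL R : List Bool}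
    (h : FL = [f0, f1, f2, f3, f4, f5, f6, f7, f8, f9]) :
    (FL ++ R).getD 0 false = f0 ∧ (FL ++ R).getD 1 false = f1 ∧ (FL ++ R).getD 2 false = f2 ∧
      (FL ++ R).getD 3 false = f3 ∧ (FL ++ R).getD 4 false = f4 ∧ (FL ++ R).getD 5 false = f5 ∧
      (FL ++ R).getD 6 false = f6 ∧ (FL ++ R).getD 7 false = f7 ∧ (FL ++ R).getD 8 false = f8 ∧
      (FL ++ R).getD 9 false = f9 := by
  subst h
  simp

open Classical in
/-- **The matrix lemma**: on the evidence of a well-formed descriptor (`|T'| = Q`, `|J₀'| = R`)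
the judge accepts iff the local check at `(⟦T'⟧, ⟦J₀'⟧)` holds for the rows `rho` claimed by the
advice. [cite: AroraBarakCC2009, Thm. 6.20 (proof)] -/
theorem judge_evidFn_iff {A : Language Bool} {d : ℕ} (hT : T'.length = qP.eval x.length + 1)
    (hJ : J'.length = hP.eval x.length + 1) :
    judge M d (evidFn M qP hP A d (boolPair (boolPair x W) (boolPair T' J'))) = true ↔
      Check d (qP.eval x.length) (hP.eval x.length) x
        (rho M A W (qP.eval x.length + 1) (hP.eval x.length + 1) x) (bitsToNat T') (bitsToNat J') := by
  rw [judge, decide_eq_true_iff, JudgeProp, evidFn_apply]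
  set FL := flattenFn (flagsFn qP hP d) (boolPair (boolPair x W) (boolPair T' J')) with hFL
  set AB := answersFn M qP hP A d (boolPair (boolPair x W) (boolPair T' J')) with hAB
  set B7 := bitFn (boolPair (boolPair x W) (boolPair T' J')) with hB7
  have hlen : FL.length = 10 := length_flags x W T' J' d
  have hdrop : (FL ++ (AB ++ B7)).drop 10 = AB ++ B7 := by rw [← hlen, List.drop_left]
  have hlenA : AB.length = nBlocks d * (allVals M).length := length_answersFn x W T' J' hT
  have hdrop' : (FL ++ (AB ++ B7)).drop (10 + nBlocks d * (allVals M).length) = B7 := by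
    rw [← List.drop_drop, hdrop, ← hlenA, List.drop_left]
  rw [hdrop, hdrop', judgeSem_congr (val' := fun i =>
      rho M A W (qP.eval x.length + 1) (hP.eval x.length + 1) x
        (rowVal (qP.eval x.length) (bitsToNat T') (blockSpec d i).1)
        (colVal (bitsToNat J') (blockSpec d i).2)) (fun i hi => judgeVal_answersFn x W T' J' hT hi B7)]
  obtain ⟨e0, e1, e2, e3, e4, e5, e6, e7, e8, e9⟩ :=
    getD_ten (R := AB ++ B7) (flagsFn_apply x W T' J' d (qP := qP) (hP := hP))
  refine judgeSem_iff (fl := fun i => (FL ++ (AB ++ B7)).getD i false)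
    (by rw [e0, hT]; simp) (by rw [e1, hT]; simp) (by rw [e2, hJ]; simp) (by rw [e3, hJ]; simp)
    e4 e5 e6 e7 e8 e9 fun i hi hix => ?_
  rw [hB7, bitFn_apply_of_le x W T' J' hi hix]
  rfl

open Classical in
/-- **Malformed descriptors are accepted**: if `|T'| ≠ Q` or `|J₀'| ≠ R` the judge accepts
(one of the first four flags is set). [folklore] -/
theorem judge_evidFn_of_ne {A : Language Bool} {d : ℕ}
    (h : T'.length ≠ qP.eval x.length + 1 ∨ J'.length ≠ hP.eval x.length + 1) :
    judge M d (evidFn M qP hP A d (boolPair (boolPair x W) (boolPair T' J'))) = true := by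
  rw [judge, decide_eq_true_iff, JudgeProp, evidFn_apply]
  obtain ⟨e0, e1, e2, e3, -⟩ := getD_ten
    (R := answersFn M qP hP A d (boolPair (boolPair x W) (boolPair T' J')) ++
      bitFn (boolPair (boolPair x W) (boolPair T' J')))
    (flagsFn_apply x W T' J' d (qP := qP) (hP := hP))
  intro hvalid
  exfalso
  obtain ⟨h0, h1, h2, h3⟩ := hvalid
  simp only [e0, e1, e2, e3, decide_eq_false_iff_not, not_lt] at h0 h1 h2 h3
  omega

end Judge

/-! ### The matrix language is in `P` -/

section Matrix

variable (qP hP : Polynomial ℕ)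

/-- **The matrix of the `Σ₂ᵖ` sentence** as a one-symbol string function: the judge applied to the
evidence. [cite: AroraBarakCC2009, Thm. 6.20 (proof)] -/
noncomputable def matFn (A : Language Bool) (d : ℕ) (u : List Bool) : List Bool :=
  [judge M d (evidFn M qP hP A d u)]

/-- **The matrix language**: the inputs `u = ⟨⟨x, W⟩, ⟨T', J₀'⟩⟩` accepted by the judge.
[cite: AroraBarakCC2009, Thm. 6.20 (proof)] -/
def MatLang (A : Language Bool) (d : ℕ) : Language Bool :=
  {u | judge M d (evidFn M qP hP A d u) = true}

variable {M qP hP}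

/-- Membership in the matrix language. [folklore] -/
theorem mem_matLang_iff {A : Language Bool} {d : ℕ} (u : List Bool) :
    u ∈ MatLang M qP hP A d ↔ judge M d (evidFn M qP hP A d u) = true :=
  Iff.rfl

/-- A `flattenFn` of functions with outputs of a common length `c`. [folklore] -/
theorem length_flattenFn_of_const {fs : List (List Bool → List Bool)} {u : List Bool} {c : ℕ}
    (h : ∀ f ∈ fs, (f u).length = c) : (flattenFn fs u).length = fs.length * c := by
  induction fs with
  | nil => simp
  | cons f fs ih =>
    rw [flattenFn_cons, List.length_append, h f (by simp), ih fun g hg => h g (by simp [hg]),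
      List.length_cons, Nat.succ_mul, Nat.add_comm]

/-- `ltFn` always outputs one symbol. [folklore] -/
theorem length_ltFn (w : List Bool) : (ltFn w).length = 1 := rfl

/-- `bitAtFn` after a pairing outputs at most one symbol. [folklore] -/
theorem length_bitFn_le (u : List Bool) : (bitFn u).length ≤ 1 := by
  unfold bitFn
  rw [Function.comp_apply, pairFn_apply, bitAtFn_boolPair]
  exact List.length_take_le _ _

/-- **The evidence word has bounded length**: at most `10 + (7d + 6) · |allVals| + 1` symbols, on
every input. [folklore] -/
theorem length_evidFn_le (A : Language Bool) (d : ℕ) (u : List Bool) :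
    (evidFn M qP hP A d u).length ≤ 10 + nBlocks d * (allVals M).length + 1 := by
  unfold evidFn
  rw [List.length_append, List.length_append]
  have h1 : (flattenFn (flagsFn qP hP d) u).length = 10 := by
    rw [length_flattenFn_of_const (c := 1)]
    · rfl
    · intro f hf
      simp only [flagsFn, List.mem_cons, List.mem_nil_iff, or_false] at hf
      rcases hf with rfl | rfl | rfl | rfl | rfl | rfl | rfl | rfl | rfl | rfl <;> exact length_ltFn _
  have h2 : (answersFn M qP hP A d u).length = nBlocks d * (allVals M).length := by
    unfold answersFn
    rw [length_flattenFn_of_const (c := (allVals M).length), List.length_map, List.length_range]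
    intro f hf
    rw [List.mem_map] at hf
    obtain ⟨i, -, rfl⟩ := hf
    rw [blockFn, length_flattenFn_of_const (c := 1), List.length_map, Nat.mul_one]
    intro g hg
    rw [List.mem_map] at hg
    obtain ⟨v, -, rfl⟩ := hg
    rfl
  have h3 := length_bitFn_le u
  omega

/-- **The matrix function is in `FP`**: the evidence is computed in polynomial time
(`evidFn_mem_FP`) and has bounded length, and every function of a bounded word is in `FP`
(`prefixFn_mem_FP`) — Arora–Barak's "`T` is some polynomial-time TM checking these conditions".
[cite: AroraBarakCC2009, Thm. 6.20 (proof)] -/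
theorem matFn_mem_FP {A : Language Bool} (hA : A ∈ Classes.P) (d : ℕ) : matFn M qP hP A d ∈ FP := by
  set B := 10 + nBlocks d * (allVals M).length + 1 with hB
  have h := comp_mem_FP (prefixFn_mem_FP B fun w => [judge M d w]) (evidFn_mem_FP M qP hP hA d)
  have e : ((fun w => (fun w => [judge M d w]) (w.take B)) ∘ evidFn M qP hP A d) = matFn M qP hP A d := by
    funext u
    simp only [Function.comp_apply, matFn]
    rw [List.take_of_length_le (length_evidFn_le A d u)]
  rwa [e] at h

/-- **The matrix language is in `P`.** [cite: AroraBarakCC2009, Thm. 6.20 (proof)] -/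
theorem matLang_mem_P {A : Language Bool} (hA : A ∈ Classes.P) (d : ℕ) : MatLang M qP hP A d ∈ Classes.P :=
  mem_P_of_mem_FP (matFn_mem_FP hA d) _ fun u =>
    ⟨fun h => by rw [matFn, (mem_matLang_iff u).1 h],
     fun h => by
      rw [mem_matLang_iff] at h
      rw [matFn, Bool.eq_false_iff.2 h]⟩

end Matrix

end Meyer

end Literature.Computability.Complexity
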